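import Literature.MathematicalPhysics.QuantumFieldTheory.QCDCalibratedSpecies
import HarnessLib

/-!
# Stub `stub_speciesPackaging` of line `birth`
(crux `Summit.QuantumFields.QCD.Theses.GapBuysCauchyRate.ConvergentOSClosure`, item stmt-QuantumFields-11525,
route route-QuantumFields-GapBuysCauchyRate)

## Summary

The packaging step of the crux.  Given a labelled Schwinger family `S` with the full OS package
(`OSAxiomsSchwinger S`) that IS the limit of the lattice `n`-point functions of a CALIBRATED family
`𝒞.scheme m` on all real tensors in `⁰𝒮`, the OS data `T := OSData.ofAxioms S _` have
`T.schwinger = S` (`rfl`) and carry the three soft clauses: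

* non-triviality of a species `s` whose calibrating two-point function
  `⟨Φ^s(Θf₀) Φ^s(f₀)⟩_k` is eventually `1` (hypotheses for `s = glue` and `s = pseudoRe f g`, `f ≠ g`):
  witnesses `F = G = f₀` (one-point tensor, time-ordered because `f₀` lives in the slab
  `τ₀/2 ≤ x⁰ ≤ τ₀`, `τ₀ > 0`), `osAdjoint F = Θf₀` (a real function), `H = Θf₀ ⊗ f₀` (off-diagonal:
  the two supports are disjoint); the limit clause at `n = 2` and the eventual calibration give
  `S₂(H) = 1`, while the one-point subtraction of a calibrated family (`onePoint_eq_zero`) gives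
  `S₁(f₀) = 0`, so `S₂(H) = 1 ≠ S₁(Θf₀) · S₁(f₀) = 0`;
* non-Gaussianity of `glue` from the lattice-side `κ₃` witness (real bumps in the pairwise disjoint
  time slabs `x⁰ < 0`, `0 < x⁰ < 1`, `1 < x⁰`): their tensors are off-diagonal by the support
  criterion, the limit clause identifies the `n = 1, 2, 3` limits, and an eventually-`≥ ε` sequence
  has a non-zero limit (`ge_of_tendsto`) — the bookkeeping of `ThreePointWitness` in
  `Theses/QuarksNoInfraredClause.lean`, with the convergence clause of `IsQCDAlong` replaced by the
  limit clause of this stub.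
-/

noncomputable section

namespace Summit.QuantumFields.QCD.Theorems.ConvergentOSClosure

open scoped BigOperators Topology SchwartzMap ComplexConjugate
open MeasureTheory Filter
open Literature.MathematicalPhysics.AQFT Literature.MathematicalPhysics.QuantumLattice
  Literature.MathematicalPhysics.QuantumFieldTheory

/-! ## Tensors of real one-point test functions: support, off-diagonality, time-ordering -/

/-- A point of the support of the tensor `⊗ᵢ fᵢ` of real test functions has every coordinate in
the support of the corresponding factor. -/
private theorem mem_tsupport_factor {n : ℕ} (f : Fin n → 𝓢(EuclideanSpace ℝ (Fin 4), ℝ))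
    {x : Fin n → EuclideanSpace ℝ (Fin 4)}
    (hx : x ∈ tsupport ((SchwartzMap.tensorFin n fun i => ofRealTest (f i)) :
      (Fin n → EuclideanSpace ℝ (Fin 4)) → ℂ))
    (i : Fin n) : x i ∈ tsupport (f i : EuclideanSpace ℝ (Fin 4) → ℝ) := by
  by_contra hi
  have h1 : ∀ᶠ y in 𝓝 x, f i (y i) = 0 :=
    ((continuous_apply i).tendsto x).eventually (notMem_tsupport_iff_eventuallyEq.mp hi)
  refine (notMem_tsupport_iff_eventuallyEq.mpr ?_) hx
  filter_upwards [h1] with y hy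
  simp only [Pi.zero_apply, SchwartzMap.tensorFin_apply, ofRealTest_apply]
  exact Finset.prod_eq_zero (Finset.mem_univ i) (by rw [hy]; simp)

/-- **Support criterion for tensors**: if the factors have pairwise disjoint supports, the tensor
`⊗ᵢ fᵢ` lies in `⁰𝒮`. -/
private theorem isOffDiagonal_tensorFin {n : ℕ} (f : Fin n → 𝓢(EuclideanSpace ℝ (Fin 4), ℝ))
    (hsep : ∀ i j, i ≠ j → ∀ z, z ∈ tsupport (f i : EuclideanSpace ℝ (Fin 4) → ℝ) →
      z ∈ tsupport (f j : EuclideanSpace ℝ (Fin 4) → ℝ) → False) :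
    IsOffDiagonal (SchwartzMap.tensorFin n fun i => ofRealTest (f i)) :=
  IsOffDiagonal.of_tsupport_subset fun x hx hmem => by
    obtain ⟨i, j, hij, hxij⟩ := hmem
    exact hsep i j hij (x i) (mem_tsupport_factor f hx i) (hxij ▸ mem_tsupport_factor f hx j)

/-- One-point tensors are off-diagonal (no pairs of distinct indices). -/
private theorem isOffDiagonal_tensorFin_one (a : 𝓢(EuclideanSpace ℝ (Fin 4), ℝ)) :
    IsOffDiagonal (SchwartzMap.tensorFin 1 fun i => ofRealTest ((![a] : Fin 1 → _) i)) :=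
  isOffDiagonal_tensorFin ![a] fun i j hij _ _ _ => hij (Subsingleton.elim i j)

/-- Two-point tensors of functions with disjoint supports are off-diagonal. -/
private theorem isOffDiagonal_tensorFin_two (a b : 𝓢(EuclideanSpace ℝ (Fin 4), ℝ))
    (hab : ∀ z, z ∈ tsupport (a : EuclideanSpace ℝ (Fin 4) → ℝ) →
      z ∈ tsupport (b : EuclideanSpace ℝ (Fin 4) → ℝ) → False) :
    IsOffDiagonal (SchwartzMap.tensorFin 2 fun i => ofRealTest ((![a, b] : Fin 2 → _) i)) := by
  refine isOffDiagonal_tensorFin ![a, b] fun i j hij z hzi hzj => ?_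
  fin_cases i <;> fin_cases j
  · exact hij rfl
  · exact hab z hzi hzj
  · exact hab z hzj hzi
  · exact hij rfl

/-- A one-point tensor of a function supported at positive times is time-ordered. -/
private theorem isTimeOrdered_tensorFin_one (g : 𝓢(EuclideanSpace ℝ (Fin 4), ℝ))
    (hg : tsupport (g : EuclideanSpace ℝ (Fin 4) → ℝ) ⊆ {x | 0 < x 0}) :
    IsTimeOrdered (SchwartzMap.tensorFin 1 fun i => ofRealTest ((![g] : Fin 1 → _) i)) := by
  intro x hx
  refine ⟨fun i => ?_, fun i j hij => absurd (Fin.lt_def.mp hij) (by omega)⟩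
  have h := mem_tsupport_factor ![g] hx i
  simp only [Matrix.cons_val_fin_one] at h
  exact hg h

/-- The OS adjoint of the one-point tensor of the reflected real bump `Θa` is the one-point tensor
of `a` itself. -/
private theorem osAdjoint_tensorFin_one_thetaTest (a : 𝓢(EuclideanSpace ℝ (Fin 4), ℝ)) :
    osAdjoint (SchwartzMap.tensorFin 1 fun i => ofRealTest ((![thetaTest 4 a] : Fin 1 → _) i)) =
      SchwartzMap.tensorFin 1 fun i => ofRealTest ((![a] : Fin 1 → _) i) := by
  ext x
  rw [osAdjoint_apply]
  simp [SchwartzMap.tensorFin_apply, thetaTest_apply, timeReflection_timeReflection]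

/-- The OS adjoint of the one-point tensor of a real bump `a` is the one-point tensor of `Θa`. -/
private theorem osAdjoint_tensorFin_one (a : 𝓢(EuclideanSpace ℝ (Fin 4), ℝ)) :
    osAdjoint (SchwartzMap.tensorFin 1 fun i => ofRealTest ((![a] : Fin 1 → _) i)) =
      SchwartzMap.tensorFin 1 fun i => ofRealTest ((![thetaTest 4 a] : Fin 1 → _) i) := by
  have h := osAdjoint_tensorFin_one_thetaTest (thetaTest 4 a)
  rwa [thetaTest_involutive 4 a] at h

/-- `a ⊗ b` is the appended tensor of the one-point tensors of `a` and `b`. -/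
private theorem isAppendTensorOf_tensorFin_two (a b : 𝓢(EuclideanSpace ℝ (Fin 4), ℝ)) :
    IsAppendTensorOf (n := 1) (m := 1)
      (SchwartzMap.tensorFin 2 fun i => ofRealTest ((![a, b] : Fin 2 → _) i))
      (SchwartzMap.tensorFin 1 fun i => ofRealTest ((![a] : Fin 1 → _) i))
      (SchwartzMap.tensorFin 1 fun i => ofRealTest ((![b] : Fin 1 → _) i)) := by
  intro x
  simp [SchwartzMap.tensorFin_apply, Fin.prod_univ_two]

/-- `![s] = fun _ => s`. -/
private theorem vec_one_eq_const {ι : Type} (s : ι) : (![s] : Fin 1 → ι) = fun _ => s := by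
  funext i; fin_cases i; rfl

/-- `![s, s] = fun _ => s`. -/
private theorem vec_two_eq_const {ι : Type} (s : ι) : (![s, s] : Fin 2 → ι) = fun _ => s := by
  funext i; fin_cases i <;> rfl

/-- `![s, s, s] = fun _ => s`. -/
private theorem vec_three_eq_const {ι : Type} (s : ι) :
    (![s, s, s] : Fin 3 → ι) = fun _ => s := by
  funext i; fin_cases i <;> rfl

/-! ## The two species witnesses -/

/-- **Non-triviality from the calibration.**  If the calibrating lattice two-point function
`⟨Φ^s(Θf₀) Φ^s(f₀)⟩_k` of species `s` is eventually `1` and `S` is the limit of the calibrated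
lattice `n`-point functions on real tensors in `⁰𝒮`, then
`S₂^{ss}(Θf₀ ⊗ f₀) = 1 ≠ 0 = S₁^{s}(Θf₀) S₁^{s}(f₀)` (the one-point functions of a calibrated
family vanish identically), i.e. `OSData.IsNontrivial` holds for `s` with witnesses
`F = G = f₀`, `H = Θf₀ ⊗ f₀`. -/
private theorem isNontrivial_of_calibration {Nf : ℕ} {reg : QCDRegularisation Nf}
    (𝒞 : CalibratedSpeciesFamily reg) (m : Fin Nf → ℝ) (s : QCDField Nf)
    (hcal : ∀ᶠ k in Filter.atTop,
      (𝒞.scheme m).twoPoint k s s (thetaTest 4 𝒞.f₀) 𝒞.f₀ = 1)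
    (S : LabelledSchwingerFamily (QCDField Nf) (EuclideanSpace ℝ (Fin 4)))
    (hOS : OSAxiomsSchwinger S)
    (hlim : ∀ n : ℕ, n ≠ 0 → ∀ (σ : Fin n → QCDField Nf)
      (f : Fin n → SchwartzMap (EuclideanSpace ℝ (Fin 4)) ℝ)
      (F : SchwartzMap (Fin n → EuclideanSpace ℝ (Fin 4)) ℂ),
      IsTensorOf F (fun i => ofRealTest (f i)) → IsOffDiagonal F →
        Filter.Tendsto (fun k : ℕ => qcdLatticeSchwinger (𝒞.scheme m) k n σ f)
          Filter.atTop (nhds (S n σ F))) :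
    (OSData.ofAxioms S hOS).IsNontrivial s := by
  -- positive-time support of `f₀` and disjointness of the reference pair
  have hpos : tsupport (𝒞.f₀ : EuclideanSpace ℝ (Fin 4) → ℝ) ⊆ {x | 0 < x 0} := fun x hx => by
    have h := (mem_timeSlab.1 (𝒞.tsupport_f₀ hx)).1
    simp only [Set.mem_setOf_eq]
    linarith [𝒞.τ₀_pos]
  have hsep : ∀ z, z ∈ tsupport (thetaTest 4 𝒞.f₀ : EuclideanSpace ℝ (Fin 4) → ℝ) →
      z ∈ tsupport (𝒞.f₀ : EuclideanSpace ℝ (Fin 4) → ℝ) → False :=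
    fun z h₁ h₂ => Set.disjoint_left.1 𝒞.disjoint_tsupport h₁ h₂
  -- the limits at `n = 2` (eventually `1`) and `n = 1` (identically `0`)
  have h2 : Filter.Tendsto (fun k : ℕ => qcdLatticeSchwinger (𝒞.scheme m) k 2 ![s, s]
      ![thetaTest 4 𝒞.f₀, 𝒞.f₀]) Filter.atTop
      (nhds (S 2 ![s, s] (SchwartzMap.tensorFin 2 fun i =>
        ofRealTest ((![thetaTest 4 𝒞.f₀, 𝒞.f₀] : Fin 2 → _) i)))) :=
    hlim 2 two_ne_zero _ _ _ (isTensorOf_tensorFin _) (isOffDiagonal_tensorFin_two _ _ hsep)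
  have h2' : Filter.Tendsto (fun k : ℕ => qcdLatticeSchwinger (𝒞.scheme m) k 2 ![s, s]
      ![thetaTest 4 𝒞.f₀, 𝒞.f₀]) Filter.atTop (nhds 1) :=
    tendsto_const_nhds.congr' (hcal.mono fun k hk => by
      rw [QCDScheme.twoPoint_eq] at hk
      exact hk.symm)
  have hval2 := tendsto_nhds_unique h2 h2'
  rw [vec_two_eq_const s] at hval2
  have h1 : Filter.Tendsto (fun k : ℕ => qcdLatticeSchwinger (𝒞.scheme m) k 1 ![s] ![𝒞.f₀])
      Filter.atTop (nhds (S 1 ![s] (SchwartzMap.tensorFin 1 fun i =>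
        ofRealTest ((![𝒞.f₀] : Fin 1 → _) i)))) :=
    hlim 1 one_ne_zero _ _ _ (isTensorOf_tensorFin _) (isOffDiagonal_tensorFin_one _)
  have h1' : Filter.Tendsto (fun k : ℕ => qcdLatticeSchwinger (𝒞.scheme m) k 1 ![s] ![𝒞.f₀])
      Filter.atTop (nhds 0) := by
    have h0 : (fun k : ℕ => qcdLatticeSchwinger (𝒞.scheme m) k 1 ![s] ![𝒞.f₀]) = fun _ => 0 := by
      funext k
      rw [vec_one_eq_const s, vec_one_eq_const 𝒞.f₀]
      exact 𝒞.onePoint_eq_zero m s k 𝒞.f₀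
    rw [h0]
    exact tendsto_const_nhds
  have hval1 := tendsto_nhds_unique h1 h1'
  rw [vec_one_eq_const s] at hval1
  -- the witnesses
  refine ⟨SchwartzMap.tensorFin 1 fun i => ofRealTest ((![𝒞.f₀] : Fin 1 → _) i),
    SchwartzMap.tensorFin 1 fun i => ofRealTest ((![𝒞.f₀] : Fin 1 → _) i),
    SchwartzMap.tensorFin 2 fun i => ofRealTest ((![thetaTest 4 𝒞.f₀, 𝒞.f₀] : Fin 2 → _) i),
    isTimeOrdered_tensorFin_one _ hpos, isTimeOrdered_tensorFin_one _ hpos, ?_, ?_⟩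
  · rw [osAdjoint_tensorFin_one]
    exact isAppendTensorOf_tensorFin_two _ _
  · rw [osAdjoint_tensorFin_one]
    change S 2 (fun _ => s) _ ≠ S 1 (fun _ => s) _ * S 1 (fun _ => s) _
    rw [hval2, hval1, mul_zero]
    exact one_ne_zero

/-- **Non-Gaussianity from the lattice `κ₃` witness** (the bookkeeping of `ThreePointWitness`):
real bumps `f, g, h` in the pairwise disjoint slabs `x⁰ < 0`, `0 < x⁰ < 1`, `1 < x⁰` whose lattice
connected three-point combination stays `≥ ε > 0` eventually, together with the limit clause, give
`OSData.IsNonGaussian` for the species `s`. -/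
private theorem isNonGaussian_of_kappa₃ {Nf : ℕ} (sch : QCDScheme Nf) (s : QCDField Nf)
    (hw : ∃ f g h : SchwartzMap (EuclideanSpace ℝ (Fin 4)) ℝ,
      tsupport (f : EuclideanSpace ℝ (Fin 4) → ℝ) ⊆ {x | x 0 < 0} ∧
      tsupport (g : EuclideanSpace ℝ (Fin 4) → ℝ) ⊆ {x | 0 < x 0 ∧ x 0 < 1} ∧
      tsupport (h : EuclideanSpace ℝ (Fin 4) → ℝ) ⊆ {x | 1 < x 0} ∧
      ∃ ε > (0 : ℝ), ∀ᶠ k in Filter.atTop, ε ≤ ‖qcdLatticeSchwinger sch k 3 ![s, s, s] ![f, g, h] -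
        qcdLatticeSchwinger sch k 1 ![s] ![f] * qcdLatticeSchwinger sch k 2 ![s, s] ![g, h] -
        qcdLatticeSchwinger sch k 1 ![s] ![g] * qcdLatticeSchwinger sch k 2 ![s, s] ![f, h] -
        qcdLatticeSchwinger sch k 1 ![s] ![h] * qcdLatticeSchwinger sch k 2 ![s, s] ![f, g] +
        2 * (qcdLatticeSchwinger sch k 1 ![s] ![f] * qcdLatticeSchwinger sch k 1 ![s] ![g] *
          qcdLatticeSchwinger sch k 1 ![s] ![h])‖)
    (S : LabelledSchwingerFamily (QCDField Nf) (EuclideanSpace ℝ (Fin 4)))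
    (hOS : OSAxiomsSchwinger S)
    (hlim : ∀ n : ℕ, n ≠ 0 → ∀ (σ : Fin n → QCDField Nf)
      (f : Fin n → SchwartzMap (EuclideanSpace ℝ (Fin 4)) ℝ)
      (F : SchwartzMap (Fin n → EuclideanSpace ℝ (Fin 4)) ℂ),
      IsTensorOf F (fun i => ofRealTest (f i)) → IsOffDiagonal F →
        Filter.Tendsto (fun k : ℕ => qcdLatticeSchwinger sch k n σ f)
          Filter.atTop (nhds (S n σ F))) :
    (OSData.ofAxioms S hOS).IsNonGaussian s := by
  obtain ⟨f, g, h, hf, hg, hh, ε, hε, hev⟩ := hw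
  -- shorthand for the real tensors (local, by `have`-abbreviations of the terms' properties)
  have hsl : ∀ (a b : SchwartzMap (EuclideanSpace ℝ (Fin 4)) ℝ) (P Q : ℝ → Prop),
      tsupport (a : EuclideanSpace ℝ (Fin 4) → ℝ) ⊆ {x | P (x 0)} →
      tsupport (b : EuclideanSpace ℝ (Fin 4) → ℝ) ⊆ {x | Q (x 0)} →
      (∀ t, P t → Q t → False) → ∀ z, z ∈ tsupport (a : EuclideanSpace ℝ (Fin 4) → ℝ) →
        z ∈ tsupport (b : EuclideanSpace ℝ (Fin 4) → ℝ) → False :=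
    fun a b P Q ha hb hPQ z h1 h2 => hPQ _ (ha h1) (hb h2)
  have hfg := hsl f g (· < 0) (fun t => 0 < t ∧ t < 1) hf hg fun t a b => by linarith [b.1]
  have hfh := hsl f h (· < 0) (1 < ·) hf hh fun t a b => by linarith
  have hgh := hsl g h (fun t => 0 < t ∧ t < 1) (1 < ·) hg hh fun t a b => by linarith [a.2]
  have h3off : IsOffDiagonal
      (SchwartzMap.tensorFin 3 fun i => ofRealTest ((![f, g, h] : Fin 3 → _) i)) := by
    refine isOffDiagonal_tensorFin ![f, g, h] fun i j hij z hzi hzj => ?_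
    fin_cases i <;> fin_cases j
    · exact hij rfl
    · exact hfg z hzi hzj
    · exact hfh z hzi hzj
    · exact hfg z hzj hzi
    · exact hij rfl
    · exact hgh z hzi hzj
    · exact hfh z hzj hzi
    · exact hgh z hzj hzi
    · exact hij rfl
  have L3 : Filter.Tendsto (fun k => qcdLatticeSchwinger sch k 3 ![s, s, s] ![f, g, h])
      Filter.atTop (nhds (S 3 ![s, s, s]
        (SchwartzMap.tensorFin 3 fun i => ofRealTest ((![f, g, h] : Fin 3 → _) i)))) :=
    hlim 3 (by norm_num) ![s, s, s] ![f, g, h] _ (isTensorOf_tensorFin _) h3off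
  have L2 : ∀ a b : SchwartzMap (EuclideanSpace ℝ (Fin 4)) ℝ,
      (∀ z, z ∈ tsupport (a : EuclideanSpace ℝ (Fin 4) → ℝ) →
        z ∈ tsupport (b : EuclideanSpace ℝ (Fin 4) → ℝ) → False) →
      Filter.Tendsto (fun k => qcdLatticeSchwinger sch k 2 ![s, s] ![a, b]) Filter.atTop
        (nhds (S 2 ![s, s]
          (SchwartzMap.tensorFin 2 fun i => ofRealTest ((![a, b] : Fin 2 → _) i)))) :=
    fun a b hab =>
      hlim 2 two_ne_zero ![s, s] ![a, b] _ (isTensorOf_tensorFin _)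
        (isOffDiagonal_tensorFin_two a b hab)
  have L1 : ∀ a : SchwartzMap (EuclideanSpace ℝ (Fin 4)) ℝ,
      Filter.Tendsto (fun k => qcdLatticeSchwinger sch k 1 ![s] ![a]) Filter.atTop
        (nhds (S 1 ![s] (SchwartzMap.tensorFin 1 fun i => ofRealTest ((![a] : Fin 1 → _) i)))) :=
    fun a => hlim 1 one_ne_zero ![s] ![a] _ (isTensorOf_tensorFin _) (isOffDiagonal_tensorFin_one a)
  have hlim' := (((L3.sub ((L1 f).mul (L2 g h hgh))).sub ((L1 g).mul (L2 f h hfh))).sub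
    ((L1 h).mul (L2 f g hfg))).add ((((L1 f).mul (L1 g)).mul (L1 h)).const_mul 2)
  have hle := ge_of_tendsto hlim'.norm hev
  have hne : S 3 ![s, s, s] (SchwartzMap.tensorFin 3 fun i => ofRealTest ((![f, g, h] : Fin 3 → _) i))
      - S 1 ![s] (SchwartzMap.tensorFin 1 fun i => ofRealTest ((![f] : Fin 1 → _) i)) *
        S 2 ![s, s] (SchwartzMap.tensorFin 2 fun i => ofRealTest ((![g, h] : Fin 2 → _) i))
      - S 1 ![s] (SchwartzMap.tensorFin 1 fun i => ofRealTest ((![g] : Fin 1 → _) i)) *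
        S 2 ![s, s] (SchwartzMap.tensorFin 2 fun i => ofRealTest ((![f, h] : Fin 2 → _) i))
      - S 1 ![s] (SchwartzMap.tensorFin 1 fun i => ofRealTest ((![h] : Fin 1 → _) i)) *
        S 2 ![s, s] (SchwartzMap.tensorFin 2 fun i => ofRealTest ((![f, g] : Fin 2 → _) i))
      + 2 * (S 1 ![s] (SchwartzMap.tensorFin 1 fun i => ofRealTest ((![f] : Fin 1 → _) i)) *
          S 1 ![s] (SchwartzMap.tensorFin 1 fun i => ofRealTest ((![g] : Fin 1 → _) i)) *
          S 1 ![s] (SchwartzMap.tensorFin 1 fun i => ofRealTest ((![h] : Fin 1 → _) i))) ≠ 0 := by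
    intro h0
    rw [h0, norm_zero] at hle
    linarith
  rw [vec_three_eq_const s, vec_two_eq_const s, vec_one_eq_const s] at hne
  have hT : ∀ {n : ℕ} (u : Fin n → SchwartzMap (EuclideanSpace ℝ (Fin 4)) ℝ)
      (uc : Fin n → SchwartzMap (EuclideanSpace ℝ (Fin 4)) ℂ), (∀ i, uc i = ofRealTest (u i)) →
      IsTensorOf (SchwartzMap.tensorFin n fun i => ofRealTest (u i)) uc := fun u uc huc x => by
    rw [SchwartzMap.tensorFin_apply]
    exact Finset.prod_congr rfl fun i _ => by rw [huc i]
  refine ⟨ofRealTest f, ofRealTest g, ofRealTest h,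
    SchwartzMap.tensorFin 3 fun i => ofRealTest ((![f, g, h] : Fin 3 → _) i),
    SchwartzMap.tensorFin 2 fun i => ofRealTest ((![g, h] : Fin 2 → _) i),
    SchwartzMap.tensorFin 2 fun i => ofRealTest ((![f, h] : Fin 2 → _) i),
    SchwartzMap.tensorFin 2 fun i => ofRealTest ((![f, g] : Fin 2 → _) i),
    SchwartzMap.tensorFin 1 fun i => ofRealTest ((![f] : Fin 1 → _) i),
    SchwartzMap.tensorFin 1 fun i => ofRealTest ((![g] : Fin 1 → _) i),
    SchwartzMap.tensorFin 1 fun i => ofRealTest ((![h] : Fin 1 → _) i),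
    hT _ _ fun i => ?_, h3off, hT _ _ fun i => ?_, hT _ _ fun i => ?_, hT _ _ fun i => ?_,
    hT _ _ fun i => ?_, hT _ _ fun i => ?_, hT _ _ fun i => ?_, ?_⟩
  all_goals first | (fin_cases i <;> rfl) | exact hne

/-! ## The stub -/

/-- **(S5) Packaging and species witnesses** of the crux `ConvergentOSClosure` (line `birth`).
Given a calibrated family `𝒞` at mass tuple `m` whose calibrating two-point functions of `glue` and
of every `pseudoRe f g` (`f ≠ g`) are eventually `1`, a lattice `κ₃` witness for `glue`, and a
labelled family `S` with the full OS package that is the limit of the calibrated lattice `n`-point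
functions on real tensors in `⁰𝒮`, the OS data `T := OSData.ofAxioms S _` satisfy
`T.schwinger = S`, `T.IsNontrivial glue`, `T.IsNonGaussian glue` and
`T.IsNontrivial (pseudoRe f g)` for all `f ≠ g`. -/
theorem stub_speciesPackaging :
    ∀ (Nf : ℕ) (reg : QCDRegularisation Nf) (𝒞 : CalibratedSpeciesFamily reg) (m : Fin Nf → ℝ), (∀ᶠ k in Filter.atTop, (𝒞.scheme m).twoPoint k QCDField.glue QCDField.glue (thetaTest 4 𝒞.f₀) 𝒞.f₀ = 1) → (∀ f g : Fin Nf, f ≠ g → ∀ᶠ k in Filter.atTop, (𝒞.scheme m).twoPoint k (QCDField.pseudoRe f g) (QCDField.pseudoRe f g) (thetaTest 4 𝒞.f₀) 𝒞.f₀ = 1) → (∃ f g h : SchwartzMap (EuclideanSpace ℝ (Fin 4)) ℝ, tsupport (f : EuclideanSpace ℝ (Fin 4) → ℝ) ⊆ {x | x 0 < 0} ∧ tsupport (g : EuclideanSpace ℝ (Fin 4) → ℝ) ⊆ {x | 0 < x 0 ∧ x 0 < 1} ∧ tsupport (h : EuclideanSpace ℝ (Fin 4) → ℝ) ⊆ {x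 | 1 < x 0} ∧ ∃ ε > (0 : ℝ), ∀ᶠ k in Filter.atTop, ε ≤ ‖qcdLatticeSchwinger (𝒞.scheme m) k 3 ![QCDField.glue, QCDField.glue, QCDField.glue] ![f, g, h] - qcdLatticeSchwinger (𝒞.scheme m) k 1 ![QCDField.glue] ![f] * qcdLatticeSchwinger (𝒞.scheme m) k 2 ![QCDField.glue, QCDField.glue] ![g, h] - qcdLatticeSchwinger (𝒞.scheme m) k 1 ![QCDField.glue] ![g] * qcdLatticeSchwinger (𝒞.scheme m) k 2 ![QCDField.glue, QCDField.glue] ![f, h] - qcdLatticeSchwinger (𝒞.scheme m) k 1 ![QCDField.glue] ![h] * qcdLatticeSchwinger (𝒞.scheme m) k 2 ![QCDField.glue, QCDField.glue] ![f, g] + 2 * (qcdLatticeSchwinger (𝒞.scheme m) k 1 ![QCDField.glue] ![f] * qcdLatticeSchwinger (𝒞.scheme m) k 1 ![QCDField.glue] ![g] * qcdLatticeSchwinger (𝒞.scheme m) k 1 ![QCDField.glue] ![h])‖) → ∀ S : LabelledSchwingerFamily (QCDField Nf) (EuclideanSpace ℝ (Fin 4)), OSAxiomsSchwinger S → (∀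 n : ℕ, n ≠ 0 → ∀ (σ : Fin n → QCDField Nf) (f : Fin n → SchwartzMap (EuclideanSpace ℝ (Fin 4)) ℝ) (F : SchwartzMap (Fin n → EuclideanSpace ℝ (Fin 4)) ℂ), IsTensorOf F (fun i => ofRealTest (f i)) → IsOffDiagonal F → Filter.Tendsto (fun k : ℕ => qcdLatticeSchwinger (𝒞.scheme m) k n σ f) Filter.atTop (nhds (S n σ F))) → ∃ T : OSData (QCDField Nf) 4, T.schwinger = S ∧ T.IsNontrivial QCDField.glue ∧ T.IsNonGaussian QCDField.glue ∧ ∀ f g : Fin Nf, f ≠ g → T.IsNontrivial (QCDField.pseudoRe f g) := by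
  intro Nf reg 𝒞 m hglue hpseudo hκ₃ S hOS hlim
  exact ⟨OSData.ofAxioms S hOS, rfl, isNontrivial_of_calibration 𝒞 m _ hglue S hOS hlim,
    isNonGaussian_of_kappa₃ (𝒞.scheme m) _ hκ₃ S hOS hlim,
    fun f g hfg => isNontrivial_of_calibration 𝒞 m _ (hpseudo f g hfg) S hOS hlim⟩

end Summit.QuantumFields.QCD.Theorems.ConvergentOSClosure

end
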